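import Summits.ValiantsHypothesis.ValiantsHypothesis.Theorems.BarrierLeverChowBenchmarkPairsHaarChain
import Summits.ValiantsHypothesis.ValiantsHypothesis.Theorems.BarrierLeverChowBenchmarkPairsPeelIterate

/-!
# Route BarrierLever — item 22038 `ChowBenchmarkPairs`, line `moore-peel`: CONJECTURE HAAR for «the row `∅` + a pendant-orderable family»
# (every sub-family of the line's rows made of the point-value row `∅` and a forest of segments — e.g. `{∅, {a₁}, …, {a_n}}` — is Haar)

Helper file (`--supports stmt-ValiantsHypothesis-22038`; cell valiant-natproofs, rung V4; seat val-np-p4 gen 23).  Closes NO item.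

The line's `stub_segmentMeanValue` rows always contain the row `∅` (`segE P ∅ T = [T = ∅]`, the point value at the origin).  The pure-splittable
predicate `PSr` (p657224) builds rows from fresh POINTS, so it never produces `∅`; but `∅` is harmless: on the first `n+1` codes the row `∅` is
`(1, 0, …, 0)` (code `0` is the empty set; later codes are nonempty), so Laplace expansion along it
(`Matrix.det_succ_row_zero`) leaves the other rows on the codes `1, …, n` — still a chain (`ChowBenchmarkHaar.benchCols_not_subset_of_lt`) — and the
kernel chain theorem `exists_table_of_chain` applies.  Result: **`haar_of_empty_pendant_order`** — rows `S 0 = ∅`, `S (t+1)` with a point in no earlier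
`S (s+1)`, `n+1 ≤ 2^h` ⇒ some table makes «these rows × the first `n+1` codes» nonsingular (the conclusion of `Stmt.haar`, its own text).  Example:
**`haar_points`** — the rows `∅, {a_0}, …, {a_{n−1}}` (`a` injective): the multilinear «Vandermonde» of the line on `W(n+1)` is nonsingular for some table.

WHAT THIS IS NOT: no stub of the line is closed; nothing on crux stmt-ValiantsHypothesis-14610 or on `VP` versus `VNP`.
-/

set_option linter.dupNamespace false

namespace Summit.ValiantsHypothesis.ValiantsHypothesis.Theorems.BarrierLever.ChowBenchmarkHaar

open Finset
open Summit.ValiantsHypothesis.ValiantsHypothesis.Theorems.BarrierLever.MoorePeel (benchCols benchCols_injective)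
open Summit.ValiantsHypothesis.ValiantsHypothesis.Theorems.BarrierLever.ChowBenchmarkPeel (segE segE_empty)
open Summit.ValiantsHypothesis.ValiantsHypothesis.Theorems.BarrierLever.ChowBenchmarkSplit (dirE dirE_one exists_table_of_chain)

/-- **HAAR for `∅` + a pendant-orderable family.**  Rows `S : Fin (n+1) → Finset (Fin h)` with `S 0 = ∅` and, for `t < n`, a point `q t ∈ S t.succ` lying in
no earlier `S s.succ` (`s < t`); `n + 1 ≤ 2^h`.  Then some table makes «these rows × the first `n+1` binary codes» nonsingular. -/
theorem haar_of_empty_pendant_order (h n : ℕ) (S : Fin (n + 1) → Finset (Fin h)) (hS0 : S 0 = ∅) (q : Fin n → Fin h)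
    (hq : ∀ t, q t ∈ S t.succ) (hfresh : ∀ s t, s < t → q t ∉ S s.succ) (hn : n + 1 ≤ 2 ^ h) :
    ∃ P : Fin h → Fin h → ℂ,
      (Matrix.of fun i j : Fin (n + 1) => segE P (S i) (benchCols h (n + 1) j)).det ≠ 0 := by
  classical
  -- the other rows on the codes 1..n form a chain
  obtain ⟨P, hP⟩ := exists_table_of_chain (π := Fin h) (κ := Fin h) n (fun t => S t.succ) (fun _ _ => 1)
    (fun t => benchCols h (n + 1) t.succ) q hq hfresh (fun _ => le_refl 1)
    (fun s t hst => benchCols_not_subset_of_lt hn s.succ t.succ (Fin.succ_lt_succ_iff.mpr hst))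
  refine ⟨P, ?_⟩
  set A : Matrix (Fin (n + 1)) (Fin (n + 1)) ℂ := Matrix.of fun i j => segE P (S i) (benchCols h (n + 1) j) with hA
  -- row 0 is (1, 0, …, 0)
  have hpos : 0 < n + 1 := Nat.succ_pos n
  have hz : benchCols h (n + 1) 0 = ∅ := by
    unfold benchCols
    exact Finset.filter_false_of_mem fun c _ => by simp
  have hrow0 : ∀ j : Fin (n + 1), A 0 j = if j = 0 then 1 else 0 := by
    intro j
    rw [hA, Matrix.of_apply, hS0, segE_empty]
    by_cases hj : j = 0
    · subst hj
      rw [if_pos hz, if_pos rfl]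
    · rw [if_neg, if_neg hj]
      intro hempty
      apply hj
      apply benchCols_injective hn
      rw [hempty, hz]
  rw [Matrix.det_succ_row_zero, Finset.sum_eq_single (0 : Fin (n + 1))]
  · rw [hrow0, if_pos rfl]
    simp only [Fin.val_zero, pow_zero, one_mul, mul_one]
    have e : A.submatrix Fin.succ (0 : Fin (n + 1)).succAbove =
        Matrix.of fun s t : Fin n => dirE P (S s.succ) ((fun _ _ => 1 : Fin n → Fin h → ℕ) s) (benchCols h (n + 1) t.succ) := by
      refine Matrix.ext fun s t => ?_
      rw [Matrix.submatrix_apply, hA, Matrix.of_apply, Matrix.of_apply, Fin.succAbove_zero, dirE_one]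
    rw [e]
    exact hP
  · intro j _ hj
    rw [hrow0, if_neg hj, mul_zero, zero_mul]
  · intro h0
    exact absurd (Finset.mem_univ _) h0

/-- **Example: the point rows.**  `∅, {a_0}, …, {a_{n−1}}` (`a` injective, `n+1 ≤ 2^h`): nonsingular on the first `n+1` codes for some table. -/
theorem haar_points (h n : ℕ) (a : Fin n → Fin h) (ha : Function.Injective a) (hn : n + 1 ≤ 2 ^ h) :
    ∃ P : Fin h → Fin h → ℂ,
      (Matrix.of fun i j : Fin (n + 1) =>
        segE P (Fin.cases (∅ : Finset (Fin h)) (fun t => ({a t} : Finset (Fin h))) i) (benchCols h (n + 1) j)).det ≠ 0 :=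
  haar_of_empty_pendant_order h n _ (by simp) a (fun t => by simp)
    (fun s t hst hmem => by
      simp only [Fin.cases_succ, Finset.mem_singleton] at hmem
      exact (ne_of_lt hst).symm (ha hmem)) hn

end Summit.ValiantsHypothesis.ValiantsHypothesis.Theorems.BarrierLever.ChowBenchmarkHaar
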